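import Literature.Topology.FourManifolds.KhEraseChord
import Literature.Topology.FourManifolds.KhTriangle
import HarnessLib

/-!
# The degenerate instance `x = z` of the third Reidemeister move `Ω3a`

Sibling file of `KhComplex.lean`. The constructor `PolyakMove.omega3a G x y z …` does not
require `x ≠ z`; when `x = z` its hypotheses say that the four passages
`underPos y, underPos x, overPos x, overPos y` are consecutive: `x` is an isolated kink inside the
span of the chord `y`, and `G.braidMove x y x` consists of two disjoint kinks `x`, `y`. Erasing
the kink `x` and then the kink `y` (`KhEraseChord.lean`: the first Reidemeister move read
backwards) from either side gives the same Gauss diagram, whence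
`Kh^{i,j}(G) ≅ Kh^{i,j}(G.braidMove x y x)` (`nonempty_iso_khovanovHomology_omega3a_degenerate`).
Together with `KhTriangleIso.lean` (`x ≠ z`) this covers every instance of `omega3a`.
No named fact is introduced.

## References

* M. Polyak, *Minimal generating sets of Reidemeister moves*, Quantum Topol. 1 (2010), §2.
  [cite: Polyak2010, §2]
* M. Khovanov, *A categorification of the Jones polynomial*, Duke Math. J. 101 (2000), §5.1.
  [cite: Khovanov2000, §5.1]
-/

open CategoryTheory Function

namespace Literature.Topology.FourManifolds

namespace GaussDiagram

section Degenerate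

variable (G : GaussDiagram) {x y : Fin G.n}

/-! ## The positions of the two kinks after the move -/

/-- In `G.braidMove x y x` the chord `x` passes over at the old `underPos x`. [folklore] -/
theorem overPos_braidMove_xx : (G.braidMove x y x).overPos x = G.underPos x := by
  show (G.mapPos (G.braidPerm x y x)).overPos _ = _
  rw [mapPos_overPos, braidPerm_apply,
    Equiv.swap_apply_of_ne_of_ne (G.overPos_ne_underPos x y) (G.overPos_ne_underPos x x),
    Equiv.swap_apply_right,
    Equiv.swap_apply_of_ne_of_ne (G.overPos_ne_underPos x x).symm (G.overPos_ne_underPos y x).symm]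

/-- In `G.braidMove x y x` the chord `x` passes under at the old `underPos y`. [folklore] -/
theorem underPos_braidMove_xx (hxy : x ≠ y) : (G.braidMove x y x).underPos x = G.underPos y := by
  show (G.mapPos (G.braidPerm x y x)).underPos _ = _
  rw [mapPos_underPos, braidPerm_apply, Equiv.swap_apply_right,
    Equiv.swap_apply_of_ne_of_ne (fun h ↦ hxy (G.underPos_injective h).symm) (G.overPos_ne_underPos x y).symm,
    Equiv.swap_apply_of_ne_of_ne (G.overPos_ne_underPos x y).symm (G.overPos_ne_underPos y y).symm]

/-- In `G.braidMove x y x` the chord `y` passes over at the old `overPos x`. [folklore] -/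
theorem overPos_braidMove_yx (hxy : x ≠ y) : (G.braidMove x y x).overPos y = G.overPos x := by
  show (G.mapPos (G.braidPerm x y x)).overPos _ = _
  rw [mapPos_overPos, braidPerm_apply,
    Equiv.swap_apply_of_ne_of_ne (G.overPos_ne_underPos y y) (G.overPos_ne_underPos y x),
    Equiv.swap_apply_of_ne_of_ne (G.overPos_ne_underPos y x) (fun h ↦ hxy (G.overPos_injective h).symm),
    Equiv.swap_apply_right]

/-- In `G.braidMove x y x` the chord `y` passes under at the old `overPos y`. [folklore] -/
theorem underPos_braidMove_yx : (G.braidMove x y x).underPos y = G.overPos y := by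
  show (G.mapPos (G.braidPerm x y x)).underPos _ = _
  rw [mapPos_underPos, braidPerm_apply, Equiv.swap_apply_left, Equiv.swap_apply_left, Equiv.swap_apply_left]

/-! ## The index of `y` after erasing `x`, and the two kinks -/

variable (x y) in
/-- **The index of `y` in `G.eraseChord x`.** [folklore] -/
def yIdx (hxy : x ≠ y) : Fin (G.n - 1) :=
  ⟨if (y : ℕ) < x then y else (y : ℕ) - 1, by
    have := x.isLt; have := y.isLt; have : (x : ℕ) ≠ y := fun h ↦ hxy (Fin.ext h)
    split_ifs <;> omega⟩

/-- `yIdx` lifts to `y`. [folklore] -/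
theorem liftIdx_yIdx (hxy : x ≠ y) : G.liftIdx x (G.yIdx x y hxy) = y := by
  apply Fin.ext
  have hv : (G.yIdx x y hxy : ℕ) = if (y : ℕ) < x then (y : ℕ) else (y : ℕ) - 1 := rfl
  rw [val_liftIdx, hv]
  have : (x : ℕ) ≠ y := fun h ↦ hxy (Fin.ext h)
  split_ifs <;> omega

variable (ha : (G.overPos y : ℕ) = G.overPos x + 1) (hb : (G.overPos x : ℕ) = G.underPos x + 1)
  (hc : (G.underPos x : ℕ) = G.underPos y + 1)

include ha hb hc in
/-- After erasing `x` from `G`, `y` is a kink entered along the under-strand. [folklore] -/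
theorem kink_eraseChord_G (hxy : x ≠ y) :
    ((G.eraseChord x).overPos (G.yIdx x y hxy) : ℕ) = (G.eraseChord x).underPos (G.yIdx x y hxy) + 1 := by
  rw [val_overPos_eraseChord, val_underPos_eraseChord, G.liftIdx_yIdx hxy]
  unfold compressVal
  split_ifs <;> omega

include ha hb hc in
/-- After erasing `x` from `G.braidMove x y x`, `y` is a kink entered along the over-strand. [folklore] -/
theorem kink_eraseChord_G' (hxy : x ≠ y) :
    (((G.braidMove x y x).eraseChord x).underPos ((G.braidMove x y x).yIdx x y hxy) : ℕ) =
      ((G.braidMove x y x).eraseChord x).overPos ((G.braidMove x y x).yIdx x y hxy) + 1 := by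
  rw [val_overPos_eraseChord, val_underPos_eraseChord, (G.braidMove x y x).liftIdx_yIdx hxy]
  unfold compressVal
  rw [G.overPos_braidMove_xx, G.underPos_braidMove_xx hxy, G.overPos_braidMove_yx hxy, G.underPos_braidMove_yx]
  split_ifs <;> omega

include hb in
/-- In `G`, `x` is a kink entered along the under-strand. [folklore] -/
theorem kink_x_G : (G.overPos x : ℕ) = G.underPos x + 1 := hb

include hc in
/-- In `G.braidMove x y x`, `x` is a kink entered along the under-strand. [folklore] -/
theorem kink_x_G' (hxy : x ≠ y) : ((G.braidMove x y x).overPos x : ℕ) = (G.braidMove x y x).underPos x + 1 := by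
  rw [G.overPos_braidMove_xx, G.underPos_braidMove_xx hxy]; exact hc

include ha hb hc in
/-- The over-passage of `y` after erasing `x` from `G`. [folklore] -/
theorem val_overPos_eraseChord_yIdx (hxy : x ≠ y) :
    ((G.eraseChord x).overPos (G.yIdx x y hxy) : ℕ) = G.underPos y + 1 := by
  rw [val_overPos_eraseChord, G.liftIdx_yIdx hxy]; unfold compressVal; split_ifs <;> omega

include hb hc in
/-- The under-passage of `y` after erasing `x` from `G`. [folklore] -/
theorem val_underPos_eraseChord_yIdx (hxy : x ≠ y) :
    ((G.eraseChord x).underPos (G.yIdx x y hxy) : ℕ) = G.underPos y := by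
  rw [val_underPos_eraseChord, G.liftIdx_yIdx hxy]; unfold compressVal; split_ifs <;> omega

include hb hc in
/-- The over-passage of `y` after erasing `x` from `G.braidMove x y x`. [folklore] -/
theorem val_overPos_eraseChord_yIdx' (hxy : x ≠ y) :
    (((G.braidMove x y x).eraseChord x).overPos ((G.braidMove x y x).yIdx x y hxy) : ℕ) = G.underPos y := by
  rw [val_overPos_eraseChord, (G.braidMove x y x).liftIdx_yIdx hxy]; unfold compressVal
  rw [G.overPos_braidMove_xx, G.underPos_braidMove_xx hxy, G.overPos_braidMove_yx hxy]
  split_ifs <;> omega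

include ha hb hc in
/-- The under-passage of `y` after erasing `x` from `G.braidMove x y x`. [folklore] -/
theorem val_underPos_eraseChord_yIdx' (hxy : x ≠ y) :
    (((G.braidMove x y x).eraseChord x).underPos ((G.braidMove x y x).yIdx x y hxy) : ℕ) = G.underPos y + 1 := by
  rw [val_underPos_eraseChord, (G.braidMove x y x).liftIdx_yIdx hxy]; unfold compressVal
  rw [G.overPos_braidMove_xx, G.underPos_braidMove_xx hxy, G.underPos_braidMove_yx]
  split_ifs <;> omega

include ha hb hc in
/-- The two compressions after erasing `x` agree off the four local passages. [folklore] -/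
theorem compressVal_eq_compressVal' (hxy : x ≠ y) {v : ℕ} (hv : v < G.underPos y ∨ (G.overPos y : ℕ) < v) :
    G.compressVal x v = (G.braidMove x y x).compressVal x v := by
  unfold compressVal
  rw [G.overPos_braidMove_xx, G.underPos_braidMove_xx hxy]
  split_ifs <;> omega

/-- A doubly lifted index is a chord other than `x` and `y`. [folklore] -/
theorem liftIdx_liftIdx_ne (hxy : x ≠ y) (k : Fin (G.n - 1 - 1)) :
    G.liftIdx x ((G.eraseChord x).liftIdx (G.yIdx x y hxy) k) ≠ x ∧
      G.liftIdx x ((G.eraseChord x).liftIdx (G.yIdx x y hxy) k) ≠ y := by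
  refine ⟨G.liftIdx_ne x _, fun h ↦ ?_⟩
  have h' := h.trans (G.liftIdx_yIdx hxy).symm
  exact (G.eraseChord x).liftIdx_ne _ k (G.liftIdx_injective x h')

include ha hb hc in
/-- A passage of a chord other than `x`, `y` lies off the four local passages. [folklore] -/
theorem off_local {c : Fin G.n} (hcx : c ≠ x) (hcy : c ≠ y) :
    ((G.overPos c : ℕ) < G.underPos y ∨ (G.overPos y : ℕ) < G.overPos c) ∧
      ((G.underPos c : ℕ) < G.underPos y ∨ (G.overPos y : ℕ) < G.underPos c) := by
  have h1 : G.overPos c ≠ G.overPos x := fun h ↦ hcx (G.overPos_injective h)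
  have h2 : G.overPos c ≠ G.overPos y := fun h ↦ hcy (G.overPos_injective h)
  have h3 := G.overPos_ne_underPos c x; have h4 := G.overPos_ne_underPos c y
  have h5 : G.underPos c ≠ G.underPos x := fun h ↦ hcx (G.underPos_injective h)
  have h6 : G.underPos c ≠ G.underPos y := fun h ↦ hcy (G.underPos_injective h)
  have h7 := G.overPos_ne_underPos x c; have h8 := G.overPos_ne_underPos y c
  have h1' := Fin.val_ne_of_ne h1; have h2' := Fin.val_ne_of_ne h2; have h3' := Fin.val_ne_of_ne h3
  have h4' := Fin.val_ne_of_ne h4; have h5' := Fin.val_ne_of_ne h5; have h6' := Fin.val_ne_of_ne h6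
  have h7' := Fin.val_ne_of_ne h7; have h8' := Fin.val_ne_of_ne h8
  constructor <;> omega

include ha hb hc in
/-- **Erasing the two kinks from either side of the degenerate move gives the same Gauss
diagram.** [folklore] -/
theorem eraseChord_eraseChord_eq (hxy : x ≠ y) :
    (G.eraseChord x).eraseChord (G.yIdx x y hxy) =
      ((G.braidMove x y x).eraseChord x).eraseChord ((G.braidMove x y x).yIdx x y hxy) := by
  have vo := G.val_overPos_eraseChord_yIdx ha hb hc hxy; have vu := G.val_underPos_eraseChord_yIdx hb hc hxy
  have vo' := G.val_overPos_eraseChord_yIdx' hb hc hxy; have vu' := G.val_underPos_eraseChord_yIdx' ha hb hc hxy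
  -- the doubly lifted indices agree as chords of `G`
  have hlift : ∀ (i : Fin ((G.eraseChord x).n - 1)) (j : Fin (((G.braidMove x y x).eraseChord x).n - 1)), (i : ℕ) = j →
      (G.braidMove x y x).liftIdx x (((G.braidMove x y x).eraseChord x).liftIdx ((G.braidMove x y x).yIdx x y hxy) j) =
        G.liftIdx x ((G.eraseChord x).liftIdx (G.yIdx x y hxy) i) := by
    intro i j hij
    apply Fin.ext
    rw [val_liftIdx, val_liftIdx, val_liftIdx, val_liftIdx]
    have e1 : ((G.braidMove x y x).yIdx x y hxy : ℕ) = (G.yIdx x y hxy : ℕ) := rfl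
    rw [e1, ← hij]
  refine ext_of_val rfl (fun i j hij ↦ ?_) (fun i j hij ↦ ?_) (fun i j hij ↦ ?_)
  · rw [val_overPos_eraseChord, val_overPos_eraseChord, val_overPos_eraseChord, val_overPos_eraseChord, hlift i j hij]
    obtain ⟨hcx, hcy⟩ := G.liftIdx_liftIdx_ne hxy i
    rw [(G.overPos_braidMove_of_ne hcx hcy hcx : (G.braidMove x y x).overPos _ = _),
      ← G.compressVal_eq_compressVal' ha hb hc hxy (G.off_local ha hb hc hcx hcy).1]
    unfold compressVal
    rw [show ((G.eraseChord x).overPos (G.yIdx x y hxy) : ℕ) = G.underPos y + 1 from vo,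
      show ((G.eraseChord x).underPos (G.yIdx x y hxy) : ℕ) = G.underPos y from vu,
      show (((G.braidMove x y x).eraseChord x).overPos ((G.braidMove x y x).yIdx x y hxy) : ℕ) = G.underPos y from vo',
      show (((G.braidMove x y x).eraseChord x).underPos ((G.braidMove x y x).yIdx x y hxy) : ℕ) = G.underPos y + 1 from vu']
    split_ifs <;> omega
  · rw [val_underPos_eraseChord, val_underPos_eraseChord, val_underPos_eraseChord, val_underPos_eraseChord, hlift i j hij]
    obtain ⟨hcx, hcy⟩ := G.liftIdx_liftIdx_ne hxy i
    rw [(G.underPos_braidMove_of_ne hcx hcy hcx : (G.braidMove x y x).underPos _ = _),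
      ← G.compressVal_eq_compressVal' ha hb hc hxy (G.off_local ha hb hc hcx hcy).2]
    unfold compressVal
    rw [show ((G.eraseChord x).overPos (G.yIdx x y hxy) : ℕ) = G.underPos y + 1 from vo,
      show ((G.eraseChord x).underPos (G.yIdx x y hxy) : ℕ) = G.underPos y from vu,
      show (((G.braidMove x y x).eraseChord x).overPos ((G.braidMove x y x).yIdx x y hxy) : ℕ) = G.underPos y from vo',
      show (((G.braidMove x y x).eraseChord x).underPos ((G.braidMove x y x).yIdx x y hxy) : ℕ) = G.underPos y + 1 from vu']
    split_ifs <;> omega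
  · rw [sign_eraseChord, sign_eraseChord, sign_eraseChord, sign_eraseChord, hlift i j hij]
    rfl

include ha hb hc in
/-- **Invariance of Khovanov homology under the degenerate instance `x = z` of `Ω3a`**: erase the
kink `x`, then the kink `y`, from both sides. Khovanov (2000), §5.1 (first move), §3.3.
[cite: Khovanov2000, §5.1] -/
theorem nonempty_iso_khovanovHomology_omega3a_degenerate (i j : ℤ) :
    Nonempty (G.khovanovHomology i j ≅ (G.braidMove x y x).khovanovHomology i j) := by
  have hxy : x ≠ y := by rintro rfl; omega
  obtain ⟨e₁⟩ := G.nonempty_iso_khovanovHomology_eraseChord_of_kink_under x hb i j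
  obtain ⟨e₂⟩ := (G.eraseChord x).nonempty_iso_khovanovHomology_eraseChord_of_kink_under (G.yIdx x y hxy)
    (G.kink_eraseChord_G ha hb hc hxy) i j
  obtain ⟨e₃⟩ := (G.braidMove x y x).nonempty_iso_khovanovHomology_eraseChord_of_kink_under x (G.kink_x_G' hc hxy) i j
  obtain ⟨e₄⟩ := ((G.braidMove x y x).eraseChord x).nonempty_iso_khovanovHomology_eraseChord_of_kink_over
    ((G.braidMove x y x).yIdx x y hxy) (G.kink_eraseChord_G' ha hb hc hxy) i j
  rw [← G.eraseChord_eraseChord_eq ha hb hc hxy] at e₄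
  exact ⟨e₁ ≪≫ e₂ ≪≫ e₄.symm ≪≫ e₃.symm⟩

end Degenerate

end GaussDiagram

end Literature.Topology.FourManifolds
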